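import Summits.Schanuel.Schanuel.Theorems.RootDecomp1KDescentEven02

/-!
# RootDecomp1KDescentEven (part 03 of 03) — CENSUS PROVENANCE for lens-1 g72 NODE 33 «THE EVEN TWIST» (CLAIM L3256; crit-1 (g13) PRICE NODE 33 L3259: ×0-AS-RECORD under RULE K-R50 (i) — a λ-support / twist-argument extension of node 19's 2-descent engine —, PORT WELCOME; NODE L3266; crit AUDIT NODE 33 / PORT GO L3269: «NODE 33 STANDS AS A THEOREM — DJ 2 (row 42) and the class DJ (2^v·3^j) decided hypothesis-free at LevelFinite / ThinFibreAt m₀ ∀ m₀; CREDIT ×0-AS-RECORD»; on PORT IDENTITY the census ledger moves row 42 → decided, UNDECIDED OF RECORD ×2 → ×1 = {36 W4})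

(census-1 g27 ×0 record port, `--supports stmt-Schanuel-33364`, no credit to anyone.  SOURCE: the lens's kernel HOME/decomp-schanuel-lens-1/g72/lean/DescentEven.lean sha256 e3ef4100266c9735… (717 l; ONE import `…RootDecomp1KDescent06`; ONE namespace `…Theorems.RootDecomp1KDescentEven` + `section Territory`; 26 theorems + `structure DescentCertE` + `def djCertE`; lens farm rc 0 · 0 sorries · 64 dupNamespace; critic AUDIT L3269: byte identity, farm rc 0, `--axioms` standard ×7, probe rc 0 / CTRL rc 1 (DJ 5), row-42 identity term by term, dependency walker Ridout-free / Literature-free with its own engine `levelFinite_of_descentCertE`) split by the census at the §3/§4 and §5/§6 boundaries for the 400-line cap: part 01 = K l.1–294 (module docstring; §0 small facts; §1 the descent lemma `descent_ev`; §2 the 2-adic Runge step `sign_choice_ev` / `runge_cover_ev`; §3 `structure DescentCertE`); part 02 = K l.295–567 (§4 `exists_sign_small_ev`; §5 the engine `nu_root_of_level_ev` / `levelFinite_of_descentCertE` / `thinFibreAt_of_descentCertE`); part 03 = K l.568–717 (§6 the class DJ (2^v·3^j): `dsNu_dj_ne_zero_even` … `def djCertE` … `levelFinite_DJ2` / `thinFibreAt_DJ2`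 / `bev_DJ2` / `DJ2_not_mem_odd_class`; section Territory `DJ2_decided`); parts 02 / 03 re-open the header (noncomputable section / namespace / the 13 `open` lines = K l.26–44 verbatim) behind `import …RootDecomp1KDescentEven0(k−1)`.  Bodies BYTE-VERBATIM; port-side modifiers: (m1) the three §0 helpers `norm_intCast_le_one_ev` / `isCoprime_num_den_ev` / `odd_psNumer_ev` live in part 02 as `private` theorems (near-duplicate flags); nothing in this part changed.  Rung 0; nothing here proves Schanuel, 33364, 33363, 31077, 31987, `ThinFibre 2`, W4 or a binder.)
-/

/-!
# RootDecomp1KDescentEven03 — lens 1, generation 72, NODE 33 «THE EVEN TWIST» — continuation (§6 the class `DJ (2^v·3^j)` — `djCertE`, `levelFinite_DJ_even`, `levelFinite_DJ2`, `thinFibreAt_DJ2`, `bev_DJ2`, `DJ2_not_mem_odd_class`; section Territory `DJ2_decided`); module docstring of record in part 01.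
-/

noncomputable section

namespace Summit.Schanuel.Schanuel.Theorems.RootDecomp1KDescentEven

open Polynomial LiouvilleNumber
open scoped Nat
open Summit.Schanuel.Schanuel.Theorems.RootDecomp1KTwoBaseCell (psNumer partialSum_eq_psNumer_div coprime_psNumer)
open Summit.Schanuel.Schanuel.Theorems.RootDecomp1KRelLiouvilleCell (partialSum_two_strictMono)
open Summit.Schanuel.Schanuel.Theorems.RootDecomp1KDegreeLadder
open Summit.Schanuel.Schanuel.Theorems.RootDecomp1KXLinear
open Summit.Schanuel.Schanuel.Theorems.RootDecomp1KXLinearII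
open Summit.Schanuel.Schanuel.Theorems.RootDecomp1KXTop
open Summit.Schanuel.Schanuel.Theorems.RootDecomp1KXAll
open Summit.Schanuel.Schanuel.Theorems.RootDecomp1KLevelFinite
open Summit.Schanuel.Schanuel.Theorems.RootDecomp1KThueMahler
open Summit.Schanuel.Schanuel.Theorems.RootDecomp1KParamThueMahler
open Summit.Schanuel.Schanuel.Theorems.RootDecomp1KLocalExponent
open Summit.Schanuel.Schanuel.Theorems.RootDecomp1KRunge
open Summit.Schanuel.Schanuel.Theorems.RootDecomp1KDescent

/-! ### §6 THE CLASS `DJ (2^v·3^j)` — in particular the boundary control `DJ 2` — UNCONDITIONAL -/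

/-- `ν_λ ≠ 0` for EVEN `λ ≠ 0`: `ν(λ, 0) = λ⁴·S(λ²)` with `S ≡ 4 (mod 8)` (tree `eval_zero_dsNu_dj`). -/
theorem dsNu_dj_ne_zero_even {l : ℤ} (hl : Even l) (hl0 : l ≠ 0) :
    dsNu djQ (djA l) (djF0 l) (djF1 l) (djF2 l) (djF3 l) ≠ 0 := by
  intro h
  have h0 := eval_zero_dsNu_dj l
  rw [h, eval_zero] at h0
  obtain ⟨k, hk⟩ := hl
  have hk0 : k ≠ 0 := by rintro rfl; simp at hk; exact hl0 hk
  have e : 5465053476 * l ^ 4 + (-111555221112) * l ^ 6 + 890861164056 * l ^ 8 + (-3322562397012) * l ^ 10 +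
      4985686562193 * l ^ 12 = k ^ 4 * (16 * (4 + 8 * (683131684 + (-55777610556) * k ^ 2 + 1781722328112 * k ^ 4 +
        (-26580499176096) * k ^ 6 + 159541969990176 * k ^ 8))) := by
    rw [hk]; ring
  rw [e] at h0
  have hk4 : k ^ 4 ≠ 0 := pow_ne_zero 4 hk0
  rcases mul_eq_zero.mp h0.symm with h4 | h4
  · exact hk4 h4
  · omega

/-- `ν_λ ≠ 0` for EVERY `λ ≠ 0` (even: `dsNu_dj_ne_zero_even`; odd: the tree's `dsNu_dj_ne_zero`). -/
theorem dsNu_dj_ne_zero_of_ne_zero {l : ℤ} (hl0 : l ≠ 0) :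
    dsNu djQ (djA l) (djF0 l) (djF1 l) (djF2 l) (djF3 l) ≠ 0 := by
  rcases Int.even_or_odd l with h | h
  · exact dsNu_dj_ne_zero_even h hl0
  · exact dsNu_dj_ne_zero h

/-- `2^v·3^j ≠ 0`. -/
theorem two_pow_mul_three_pow_ne_zero (v j : ℕ) : ((2 : ℤ) ^ v * 3 ^ j) ≠ 0 := by positivity

/-- **THE FAMILY CERTIFICATE, even class** — the tree's ONE certificate, polynomial in `λ` (`dj*`, identities
`dj_hT … dj_hOm` proved for every `λ : ℤ`), instantiated at `λ := 2^v·3^j`. -/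
def djCertE (v j : ℕ) : DescentCertE djQ (djA ((2 : ℤ) ^ v * 3 ^ j)) where
  v := v
  j := j
  T := djT
  Ba := djBa ((2 : ℤ) ^ v * 3 ^ j)
  Bb := djBb ((2 : ℤ) ^ v * 3 ^ j)
  Rz := djRz ((2 : ℤ) ^ v * 3 ^ j)
  Sz := djSz ((2 : ℤ) ^ v * 3 ^ j)
  V := djV ((2 : ℤ) ^ v * 3 ^ j)
  W := djW ((2 : ℤ) ^ v * 3 ^ j)
  U₁ := djU1 ((2 : ℤ) ^ v * 3 ^ j)
  U₂ := djU2 ((2 : ℤ) ^ v * 3 ^ j)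
  F0 := djF0 ((2 : ℤ) ^ v * 3 ^ j)
  F1 := djF1 ((2 : ℤ) ^ v * 3 ^ j)
  F2 := djF2 ((2 : ℤ) ^ v * 3 ^ j)
  F3 := djF3 ((2 : ℤ) ^ v * 3 ^ j)
  Om := djOm ((2 : ℤ) ^ v * 3 ^ j)
  m := djM ((2 : ℤ) ^ v * 3 ^ j)
  D := djD ((2 : ℤ) ^ v * 3 ^ j)
  eis := eisQ_djQ
  hA := natDegree_djA_le _
  hTdeg := natDegree_djT_le
  hT := dj_hT _
  hbez := dj_hbez _
  hm := by rw [djM]; positivity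
  hD := by rw [djD]; positivity
  hR := dj_hR _
  hS := dj_hS _
  hRV := dj_hRV _
  hSW := dj_hSW _
  hF0 := natDegree_djF0_le _
  hF1 := natDegree_djF1_le _
  hF2 := natDegree_djF2_le _
  hF3 := natDegree_djF3_le _
  hOm := dj_hOm _
  hnu := dsNu_dj_ne_zero_of_ne_zero (two_pow_mul_three_pow_ne_zero v j)

/-- **THE CLASS `DJ (2^v·3^j)`, UNCONDITIONAL.**  `LevelFinite (DJ (2^v·3^j))` for every `v j : ℕ` — hypothesis-free
(for `v = 0` this is the tree's `levelFinite_DJ j`). -/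
theorem levelFinite_DJ_even (v j : ℕ) : LevelFinite (DJ ((2 : ℤ) ^ v * 3 ^ j)) :=
  levelFinite_of_descentCertE (djCertE v j)

/-- … hence the K-line residual for the whole class at EVERY `m₀`. -/
theorem thinFibreAt_DJ_even (v j m₀ : ℕ) : ThinFibreAt m₀ (DJ ((2 : ℤ) ^ v * 3 ^ j)) :=
  thinFibreAt_of_descentCertE (djCertE v j) m₀

/-- **FINITELY MANY LEVEL POINTS OF BOUNDED HEIGHT, no proviso** (the fibres of `DJ λ` are all non-degenerate:
tree `levelSet_DJ`). -/
theorem levels_DJ_even_finite (v j : ℕ) (C : ℝ) :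
    {N : ℕ | ∃ r : ℚ, |(r : ℝ)| ≤ C ∧ bev (DJ ((2 : ℤ) ^ v * 3 ^ j)) (partialSum 2 N) r = 0}.Finite := by
  rw [← levelSet_DJ]; exact levelFinite_DJ_even v j C

/-- `DJ 2 = DJ (2^1·3^0)`. -/
theorem DJ_two_eq : DJ 2 = DJ ((2 : ℤ) ^ 1 * 3 ^ 0) := by norm_num

/-- **THE BOUNDARY CONTROL `DJ 2`** (census LIVENESS row 42: `P = (Y⁴+3Y³+3Y²+3)·x² + 4(9Y³+21Y²−9Y+18)·(2x+1)`,
genus 3, four poles of `x`, UNDECIDED of record) **is DECIDED, hypothesis-free: `LevelFinite (DJ 2)`.** -/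
theorem levelFinite_DJ2 : LevelFinite (DJ 2) := by rw [DJ_two_eq]; exact levelFinite_DJ_even 1 0

/-- … hence `ThinFibreAt m₀ (DJ 2)` for EVERY `m₀`. -/
theorem thinFibreAt_DJ2 (m₀ : ℕ) : ThinFibreAt m₀ (DJ 2) := by rw [DJ_two_eq]; exact thinFibreAt_DJ_even 1 0 m₀

/-- in particular the K-line residual at `m₀ = 2` for `DJ 2`. -/
theorem thinFibreAt_two_DJ2 : ThinFibreAt 2 (DJ 2) := thinFibreAt_DJ2 2

/-- the level set of `DJ 2` below any height `C` is finite, with no proviso. -/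
theorem levels_DJ2_finite (C : ℝ) :
    {N : ℕ | ∃ r : ℚ, |(r : ℝ)| ≤ C ∧ bev (DJ 2) (partialSum 2 N) r = 0}.Finite := by
  rw [← levelSet_DJ]; exact levelFinite_DJ2 C

/-- `DJ 2` expanded: `P(x, Y) = (Y⁴+3Y³+3Y²+3)·x² + 4·(18 − 9Y + 21Y² + 9Y³)·(2x+1)`. -/
theorem bev_DJ2 (x y : ℝ) :
    bev (DJ 2) x y = x ^ 2 * (y ^ 4 + 3 * y ^ 3 + 3 * y ^ 2 + 3) + (2 * x + 1) * (4 * (18 - 9 * y + 21 * y ^ 2 + 9 * y ^ 3)) := by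
  rw [bev_DJ]
  simp only [djQ, djA, map_add, map_mul, map_pow, map_intCast, map_neg, map_ofNat, aeval_X]
  push_cast
  ring

/-- `DJ 2` is NOT a member of the tree's class `{DJ 3^j}` (`P(0,0) = 18λ²`: `72 ≠ 18·9^j`). -/
theorem DJ2_not_mem_odd_class (j : ℕ) : DJ 2 ≠ DJ ((3 : ℤ) ^ j) := by
  intro h
  have h' := congrArg (fun P : ℤ[X][X] => bev P 0 0) h
  simp only [bev_DJ_zero_zero] at h'
  push_cast at h'
  have h3 : ((3 : ℝ) ^ j) ^ 2 = (2 : ℝ) ^ 2 := by nlinarith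
  have h4 : (3 : ℝ) ^ j = 2 := (pow_left_inj₀ (by positivity) (by positivity) two_ne_zero).mp h3
  have h5 : (3 : ℕ) ^ j = 2 := by exact_mod_cast h4
  cases j with
  | zero => norm_num at h5
  | succ n => rw [pow_succ] at h5; omega

section Territory

open Summit.Schanuel.Schanuel.Theorems.RootDecomp1KIntegrality (GaussAt)
open Summit.Schanuel.Schanuel.Theorems.RootDecomp1KSubspaceBranch (SepTopAt)

/-- **`DJ 2` DECIDED with its TERRITORY** (tree `DJ_territory_of_ne_zero` at `λ = 2`): `x`-degree 2, `Y`-degree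
`4 = 2·xdeg`, top `Q` irreducible over `ℚ` of full degree with a `ℚ₂`-root and no rational root, `eTop = 0`, not
`DecidedAt 2`, not `LocalAt 2`, not `GaussAt m₀`, not `XLinTM`, not `XLinearLt`, outside the shapes `xLinP`,
`twoTermP`, `normShapeCurve`, `3 ≤ thinThreshold`, `SepTopAt 2` — AND `LevelFinite (DJ 2)`, `ThinFibreAt 2 (DJ 2)`. -/
theorem DJ2_decided :
    (xdeg (DJ 2) = 2 ∧ (DJ 2).natDegree = 4 ∧ topX (DJ 2) = djQ ∧
      Irreducible ((topX (DJ 2)).map (Int.castRingHom ℚ)) ∧ (topX (DJ 2)).natDegree = (DJ 2).natDegree ∧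
      ¬ (DJ 2).natDegree < 2 * xdeg (DJ 2) ∧
      (∃ z : ℚ_[2], aeval z (topX (DJ 2)) = 0) ∧ (∀ q : ℚ, aeval q (topX (DJ 2)) ≠ 0) ∧
      ((topX (DJ 2)).map (Int.castRingHom ℚ)).Separable ∧ eTop (DJ 2) = 0 ∧
      (∀ (K : Type) [Field K] [CharZero K] (β : K), aeval β (topX (DJ 2)) = 0 → aeval β (xCoeff (DJ 2) 1) ≠ 0) ∧
      ¬ DecidedAt 2 (DJ 2) ∧ ¬ LocalAt 2 (DJ 2) ∧ (∀ m₀, ¬ GaussAt m₀ (DJ 2)) ∧ ¬ XLinTM (DJ 2) ∧ ¬ XLinearLt (DJ 2) ∧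
      (∀ A B, DJ 2 ≠ xLinP A B) ∧ (∀ k B A, DJ 2 ≠ twoTermP k B A) ∧ (∀ g q n D, DJ 2 ≠ normShapeCurve g q n D) ∧
      3 ≤ thinThreshold (DJ 2) ∧ SepTopAt 2 (DJ 2)) ∧
    LevelFinite (DJ 2) ∧ ThinFibreAt 2 (DJ 2) :=
  ⟨DJ_territory_of_ne_zero (by norm_num : (2 : ℤ) ≠ 0), levelFinite_DJ2, thinFibreAt_two_DJ2⟩

end Territory

end Summit.Schanuel.Schanuel.Theorems.RootDecomp1KDescentEven

end
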